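import Summits.HodgeConjecture.HodgeConjecture.Theorems.K2E3GL3CharpolyDiscNull         -- ★ `discr_charpoly_map_eval` (3 × 3: `disc χ` commutes with evaluation of polynomial matrices)
import Summits.HodgeConjecture.HodgeConjecture.Theorems.K2E3CharpolyRootsPerturbation   -- ★ `separable_of_discr_ne_zero`
import Literature.AlgebraicGeometry.Villamayor2007.MultiplicationCharpoly                 -- ★ `charpoly_smul_comp_C_mul_X` (`χ_{cM}(cT) = cⁿ χ_M(T)`)
import HarnessLib

/-!
# R90-TF · S4 (Ch. 13.1–2) · (SING-ε) FILE 1 — the ε-NORM DISCRIMINANT AS A POLYNOMIAL IN REAL COORDINATES (generic algebra):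
# for a field `K` with a ring endomorphism `σ` and `θ` with `σ θ = −θ`, the `3 × 3` «twisted norm» `δ ↦ δ·B·adj(σδ)ᵀ·C` has `disc χ` a polynomial in the
# `18` coordinates `δ = x + θ y`, non-zero as soon as one value is regular, and vanishing wherever `δ · (B·(σδ)ᵀ⁻¹·C)` is not regular semisimple
# (Rogawski 1990 §3.11 p. 34, §4.10 p. 57: `N(δ) = δ ε(δ)`, `ε(δ) = Φ⁻¹ ᵗ(σδ)⁻¹ Φ`; Harish-Chandra 1970 Lemma 42)

Cell `hodgecm-mathlib`, crux H413 (`stmt-HodgeConjecture-24833`, lane `--supports … --as helper`, count-neutral), route of record `HCCMUnconditional`;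
programme R90-TF, section S4 = Rogawski Ch. 13.1–2 (base `R90-C131`), brick **(SING-ε)** of the (B1) T-WIF plan of record (HEADS v2 §3, RULING S4-R27; dealer K2E2-plan
(g7) GO 00:46:48Z), FILE 1 of 2; hand R90-C131-p04 (g2).  THEOREMS ONLY (no definition, no instance, no notation, no named fact, no `sorry`); ★-only imports.

WHY.  (SING-ε) = «the ε-singular set `{δ ∈ G̃_v | N(δ) = δ ε(δ) not regular}` of `G̃_v = GL₃(L ⊗ L⁺_v)` is Haar-null».  FILE 2 proves it by the SHEAR CRITERION
(★ `Literature.MeasureTheory.Constructions.measure_eq_zero_of_forall_shear_null`) with the full `18`-dimensional `L⁺_v`-chart `δ = x + θ y` of `M₃(L ⊗ L⁺_v)`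
(★ `QuadraticLocalBaseChange.quadraticLocalEquiv`) as parameter space, so that each fibre is the zero set of a polynomial in `18` REAL coordinates
(★ `pi_zeroLocus_mvPolynomial_eq_zero`).  This file is the field-theoretic part, over an ARBITRARY field `K` with `σ : K →+* K`, `θ` (`σ θ = −θ`) and two fixed
matrices `B, C` (in FILE 2: `B = Φ⁻¹`, `C = Φ`):
* §1 `separable_charpoly_smul` — for `c ≠ 0`, `χ_{c•M}` is separable iff `χ_M` is (★ Villamayor `charpoly_smul_comp_C_mul_X`: `χ_{cM}(cT) = cⁿ χ_M(T)`; coprimality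
  with the derivative is stable under composition with `c·X`).
* §2 `discr_charpoly_twistedNorm_eq_zero_of_not_separable` — for `δ ∈ GL₃(K)` with `det σδ ≠ 0`: if `χ` of `δ·(B·((σδ)⁻¹)ᵀ·C)` is NOT separable then
  `disc χ(δ·B·adj(σδ)ᵀ·C) = 0` (`(σδ)⁻¹ = (det σδ)⁻¹ • adj σδ`, §1, ★ `separable_of_discr_ne_zero`).
* §3 `exists_mvPolynomial_twistedNorm_discr` — THE POLYNOMIAL: for every `g ∈ M₃(K)` there is `P ∈ K[X₀,…,X₁₇]` with
  `eval_y P = disc χ((X_y·g)·B·adj(X̄_y·σg)ᵀ·C)` for ALL `y : Fin 18 → K`, where `X_y = (y_{ij0} + θ y_{ij1})`, `X̄_y = (y_{ij0} − θ y_{ij1})` (indices through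
  `finProdFinEquiv`); and `P ≠ 0` as soon as SOME `σ`-fixed `y` makes that discriminant non-zero (for FILE 2: `X_y·g = diag(1,2,4)`).  At `σ`-fixed `y`,
  `X̄_y = σ(X_y)`, so `eval_y P` is the discriminant of §2 at `δ = X_y·g` (`twistedNorm_discr_eval_of_fixed`).

HONEST LABEL: count-neutral helper; pure algebra, pays nothing by itself ((SING-ε) is one by-shape input of the (B1) T-WIF assembly behind the OPEN (W-NP) socket of
S4 FILE C).  HC_CM is proved only modulo the 7 printed citations (2 remaining named inputs: hLiu418 = `stmt-HodgeConjecture-24832`, h413 = `stmt-HodgeConjecture-24833`)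
until rung 0 closes.  REL ≠ ★ ≠ BUILT.

## References
* [Rogawski1990] J. D. Rogawski, *Automorphic Representations of Unitary Groups in Three Variables*, Ann. of Math. Stud. 123 (1990): §3.11 p. 34 (`ε`, `N(δ) = δε(δ)`,
  ε-regular elements), §4.10 p. 57, §12.5 p. 186 (the twisted Weyl integration formula).
* [HarishChandra1970] Harish-Chandra (notes by G. van Dijk), *Harmonic analysis on reductive p-adic groups*, LNM 162 (1970), Lemma 42 (singular sets are null).
* [BravoVillamayor2010] A. Bravo, O. Villamayor, *Singularities in positive characteristic, stratification and simplification of the singular locus*, Adv. Math. 224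
  (2010), Par. 2.8 (2.8.1) (`χ_{cM}(cT) = cⁿ χ_M(T)`).
* [Cassels1986] J. W. S. Cassels, *Local Fields* (1986), Ch. 4 §3 (discriminant and separability).
-/

set_option autoImplicit false
-- the mandated namespace repeats the single-problem summit's segment (`HodgeConjecture.HodgeConjecture`)
set_option linter.dupNamespace false

noncomputable section

open Polynomial Matrix
open Summit.HodgeConjecture.HodgeConjecture.Cruxes.H413
open scoped MatrixGroups

namespace Summit.HodgeConjecture.HodgeConjecture.R90.S4

/-! ## §1 Separability of the characteristic polynomial is invariant under non-zero scalars -/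

section Scaling

variable {K : Type*} [Field K] {n : Type*} [Fintype n] [DecidableEq n]

/-- Coprimality in `K[X]` is stable under composition with the unit-slope line `c·X` (`c ≠ 0`): compose a Bézout identity. [cite: Cassels1986, Ch. 4 §3] -/
theorem isCoprime_comp_C_mul_X {p q : K[X]} (h : IsCoprime p q) (c : K) :
    IsCoprime (p.comp (C c * X)) (q.comp (C c * X)) := by
  obtain ⟨a, b, hab⟩ := h
  refine ⟨a.comp (C c * X), b.comp (C c * X), ?_⟩
  have := congrArg (fun r : K[X] => r.comp (C c * X)) hab
  simpa only [add_comp, mul_comp, one_comp] using this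

/-- If `p` is separable then so is `p ∘ (c·X)` for `c ≠ 0` (`(p ∘ cX)′ = c · p′ ∘ cX`). [cite: Cassels1986, Ch. 4 §3] -/
theorem separable_comp_C_mul_X {p : K[X]} (hp : p.Separable) {c : K} (hc : c ≠ 0) : (p.comp (C c * X)).Separable := by
  rw [separable_def] at hp ⊢
  have h1 : IsCoprime (p.comp (C c * X)) ((derivative p).comp (C c * X)) := isCoprime_comp_C_mul_X hp c
  rw [derivative_comp]
  have hd : derivative (C c * X : K[X]) = C c := by
    rw [derivative_mul, derivative_C, zero_mul, derivative_X, mul_one, zero_add]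
  rw [hd]
  exact (isCoprime_mul_unit_left_right (isUnit_C.2 (Ne.isUnit hc)) _ _).2 h1

/-- **`χ_{c•M}` separable ⇐ `χ_M` separable** for `c ≠ 0`: `χ_{cM} = cⁿ · χ_M ∘ (c⁻¹X)` (★ `charpoly_smul_comp_C_mul_X` at `(c•M, c⁻¹)`).
[cite: BravoVillamayor2010, Par. 2.8 (2.8.1)] -/
theorem separable_charpoly_smul (M : Matrix n n K) {c : K} (hc : c ≠ 0) (h : M.charpoly.Separable) : (c • M).charpoly.Separable := by
  -- `χ_M ∘ (c⁻¹ X) = c⁻ⁿ χ_{cM}` from the identity at `(c • M, c⁻¹)`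
  have key := Literature.AlgebraicGeometry.Villamayor2007.charpoly_smul_comp_C_mul_X (c • M) c⁻¹
  rw [smul_smul, inv_mul_cancel₀ hc, one_smul] at key
  -- so `χ_{cM} = C cⁿ * (χ_M ∘ c⁻¹X)`
  have hcn : (C c⁻¹ : K[X]) ^ Fintype.card n * C c ^ Fintype.card n = 1 := by
    rw [← mul_pow, ← C_mul, inv_mul_cancel₀ hc, C_1, one_pow]
  have hq : (c • M).charpoly = C c ^ Fintype.card n * M.charpoly.comp (C c⁻¹ * X) := by
    rw [key, ← mul_assoc, mul_comm (C c ^ Fintype.card n), hcn, one_mul]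
  rw [hq, mul_comm]
  exact (separable_comp_C_mul_X h (inv_ne_zero hc)).mul_unit ((isUnit_C.2 (Ne.isUnit hc)).pow _)

/-- The `iff` form of `separable_charpoly_smul`. [cite: BravoVillamayor2010, Par. 2.8 (2.8.1)] -/
theorem separable_charpoly_smul_iff (M : Matrix n n K) {c : K} (hc : c ≠ 0) : (c • M).charpoly.Separable ↔ M.charpoly.Separable := by
  refine ⟨fun h => ?_, separable_charpoly_smul M hc⟩
  have h' := separable_charpoly_smul (c • M) (inv_ne_zero hc) h
  rwa [smul_smul, inv_mul_cancel₀ hc, one_smul] at h'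

end Scaling

/-! ## §2 The twisted norm: non-separability forces the polynomial discriminant to vanish -/

section TwistedNorm

variable {K : Type*} [Field K] (σ : K →+* K)

/-- **If `χ` of `δ·(B·((σδ)⁻¹)ᵀ·C)` is not separable then `disc χ(δ·B·adj(σδ)ᵀ·C) = 0`** (`δ ∈ M₃(K)` with `det σδ ≠ 0`): `((σδ)⁻¹)ᵀ = (det σδ)⁻¹ • adj(σδ)ᵀ`,
so the two matrices differ by the non-zero scalar `(det σδ)⁻¹` (§1), and a monic cubic with non-zero discriminant is separable (★ `separable_of_discr_ne_zero`).
In FILE 2: `B = Φ⁻¹`, `C = Φ`, and `δ·(Φ⁻¹·((σδ)⁻¹)ᵀ·Φ) = N(δ) = δ ε(δ)`. [cite: Rogawski1990, §3.11 p. 34; §4.10 p. 57] [cite: Cassels1986, Ch. 4 §3] -/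
theorem discr_charpoly_twistedNorm_eq_zero_of_not_separable (B C δ : Matrix (Fin 3) (Fin 3) K) (hdet : (δ.map σ).det ≠ 0)
    (h : ¬ (δ * (B * ((δ.map σ)⁻¹)ᵀ * C)).charpoly.Separable) :
    (δ * B * (adjugate (δ.map σ))ᵀ * C).charpoly.discr = 0 := by
  by_contra hne
  apply h
  have hsep : (δ * B * (adjugate (δ.map σ))ᵀ * C).charpoly.Separable :=
    K2E3CharpolyRootsPerturbation.separable_of_discr_ne_zero (Matrix.charpoly_monic _)
      (by rw [Matrix.charpoly_natDegree_eq_dim, Fintype.card_fin]; norm_num) hne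
  have hinv : ((δ.map σ)⁻¹)ᵀ = (δ.map σ).det⁻¹ • (adjugate (δ.map σ))ᵀ := by
    rw [Matrix.inv_def, Ring.inverse_eq_inv', Matrix.transpose_smul]
  have heq : δ * (B * ((δ.map σ)⁻¹)ᵀ * C) = (δ.map σ).det⁻¹ • (δ * B * (adjugate (δ.map σ))ᵀ * C) := by
    rw [hinv, Matrix.mul_smul, Matrix.smul_mul, Matrix.mul_smul]
    simp only [Matrix.mul_assoc]
  rw [heq]
  exact separable_charpoly_smul _ (inv_ne_zero hdet) hsep

end TwistedNorm

/-! ## §3 The discriminant of the twisted norm is a polynomial in the `18` real coordinates `δ = x + θ y` -/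

section Poly

variable {K : Type*} [Field K] (σ : K →+* K) (θ : K)

/-- **THE POLYNOMIAL.**  For `g, h, B, C ∈ M₃(K)` and `θ ∈ K` there is `P ∈ K[X₀, …, X₁₇]` such that for EVERY `y : Fin 18 → K`,
`eval_y P = disc χ((X_y·g)·B·adj(X̄_y·h)ᵀ·C)` with `X_y = (y_{ij0} + θ·y_{ij1})_{ij}`, `X̄_y = (y_{ij0} − θ·y_{ij1})_{ij}` (coordinates indexed by
`finProdFinEquiv (finProdFinEquiv (i, j), k) : Fin 18`), and `P ≠ 0` provided the discriminant is non-zero at SOME `y₀` — the universal matrices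
`(X_{ij0} ± C θ · X_{ij1})` over `K[X₀,…,X₁₇]`, evaluated entrywise (★ `discr_charpoly_map_eval`, `RingHom.map_adjugate`, `Matrix.map_mul`).
[cite: Rogawski1990, §3.11 p. 34] [cite: HarishChandra1970, Lemma 42] -/
theorem exists_mvPolynomial_twistedNorm_discr (g h B C : Matrix (Fin 3) (Fin 3) K) :
    ∃ P : MvPolynomial (Fin 18) K,
      (∀ y : Fin 18 → K,
        MvPolynomial.eval y P =
          ((Matrix.of fun i j : Fin 3 => y (finProdFinEquiv (finProdFinEquiv (i, j), (0 : Fin 2))) +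
                θ * y (finProdFinEquiv (finProdFinEquiv (i, j), (1 : Fin 2)))) * g * B *
            (adjugate ((Matrix.of fun i j : Fin 3 => y (finProdFinEquiv (finProdFinEquiv (i, j), (0 : Fin 2))) -
                θ * y (finProdFinEquiv (finProdFinEquiv (i, j), (1 : Fin 2)))) * h))ᵀ * C).charpoly.discr) ∧
      ((∃ y₀ : Fin 18 → K,
          ((Matrix.of fun i j : Fin 3 => y₀ (finProdFinEquiv (finProdFinEquiv (i, j), (0 : Fin 2))) +
                θ * y₀ (finProdFinEquiv (finProdFinEquiv (i, j), (1 : Fin 2)))) * g * B *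
            (adjugate ((Matrix.of fun i j : Fin 3 => y₀ (finProdFinEquiv (finProdFinEquiv (i, j), (0 : Fin 2))) -
                θ * y₀ (finProdFinEquiv (finProdFinEquiv (i, j), (1 : Fin 2)))) * h))ᵀ * C).charpoly.discr ≠ 0) → P ≠ 0) := by
  classical
  -- the universal matrices over `R = K[X₀,…,X₁₇]`
  let A : Matrix (Fin 3) (Fin 3) (MvPolynomial (Fin 18) K) := Matrix.of fun i j =>
    MvPolynomial.X (finProdFinEquiv (finProdFinEquiv (i, j), (0 : Fin 2))) +
      MvPolynomial.C θ * MvPolynomial.X (finProdFinEquiv (finProdFinEquiv (i, j), (1 : Fin 2)))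
  let Abar : Matrix (Fin 3) (Fin 3) (MvPolynomial (Fin 18) K) := Matrix.of fun i j =>
    MvPolynomial.X (finProdFinEquiv (finProdFinEquiv (i, j), (0 : Fin 2))) -
      MvPolynomial.C θ * MvPolynomial.X (finProdFinEquiv (finProdFinEquiv (i, j), (1 : Fin 2)))
  let U : Matrix (Fin 3) (Fin 3) (MvPolynomial (Fin 18) K) :=
    A * g.map MvPolynomial.C * B.map MvPolynomial.C * (adjugate (Abar * h.map MvPolynomial.C))ᵀ * C.map MvPolynomial.C
  -- evaluation of the universal matrices
  have hA : ∀ y : Fin 18 → K, A.map (MvPolynomial.eval y) =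
      Matrix.of fun i j : Fin 3 => y (finProdFinEquiv (finProdFinEquiv (i, j), (0 : Fin 2))) +
        θ * y (finProdFinEquiv (finProdFinEquiv (i, j), (1 : Fin 2))) := by
    intro y; ext i j
    simp only [A, Matrix.map_apply, Matrix.of_apply, map_add, map_mul, MvPolynomial.eval_X, MvPolynomial.eval_C]
  have hAbar : ∀ y : Fin 18 → K, Abar.map (MvPolynomial.eval y) =
      Matrix.of fun i j : Fin 3 => y (finProdFinEquiv (finProdFinEquiv (i, j), (0 : Fin 2))) -
        θ * y (finProdFinEquiv (finProdFinEquiv (i, j), (1 : Fin 2))) := by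
    intro y; ext i j
    simp only [Abar, Matrix.map_apply, Matrix.of_apply, map_sub, map_mul, MvPolynomial.eval_X, MvPolynomial.eval_C]
  have hconst : ∀ (y : Fin 18 → K) (M : Matrix (Fin 3) (Fin 3) K), (M.map MvPolynomial.C).map (MvPolynomial.eval y) = M := by
    intro y M; ext i j
    simp only [Matrix.map_apply, MvPolynomial.eval_C]
  have hU : ∀ y : Fin 18 → K, U.map (MvPolynomial.eval y) =
      (Matrix.of fun i j : Fin 3 => y (finProdFinEquiv (finProdFinEquiv (i, j), (0 : Fin 2))) +
            θ * y (finProdFinEquiv (finProdFinEquiv (i, j), (1 : Fin 2)))) * g * B *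
        (adjugate ((Matrix.of fun i j : Fin 3 => y (finProdFinEquiv (finProdFinEquiv (i, j), (0 : Fin 2))) -
            θ * y (finProdFinEquiv (finProdFinEquiv (i, j), (1 : Fin 2)))) * h))ᵀ * C := by
    intro y
    have hadj : (adjugate (Abar * h.map MvPolynomial.C)).map (MvPolynomial.eval y) =
        adjugate (Abar.map (MvPolynomial.eval y) * (h.map MvPolynomial.C).map (MvPolynomial.eval y)) := by
      have := RingHom.map_adjugate (MvPolynomial.eval y) (Abar * h.map MvPolynomial.C)
      rw [RingHom.mapMatrix_apply, RingHom.mapMatrix_apply] at this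
      rw [this, Matrix.map_mul]
    simp only [U, Matrix.map_mul, Matrix.transpose_map, hadj, hA, hAbar, hconst]
  refine ⟨U.charpoly.discr, fun y => ?_, ?_⟩
  · rw [← K2E3GL3CharpolyDiscNull.discr_charpoly_map_eval U y, hU y]
  · rintro ⟨y₀, hy₀⟩ hP
    apply hy₀
    rw [← hU y₀, K2E3GL3CharpolyDiscNull.discr_charpoly_map_eval U y₀, hP, map_zero]

/-- **At a `σ`-fixed coordinate vector the conjugate chart IS the conjugate**: if `σ θ = −θ` and `σ (y n) = y n` for all `n`, then
`σ(X_y) = X̄_y` entrywise, hence `σ(X_y · g) = X̄_y · σ(g)`. [cite: Rogawski1990, §3.11 p. 34] -/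
theorem map_chart_mul_eq_of_fixed (hθ : σ θ = -θ) (g : Matrix (Fin 3) (Fin 3) K) (y : Fin 18 → K) (hy : ∀ n, σ (y n) = y n) :
    ((Matrix.of fun i j : Fin 3 => y (finProdFinEquiv (finProdFinEquiv (i, j), (0 : Fin 2))) +
          θ * y (finProdFinEquiv (finProdFinEquiv (i, j), (1 : Fin 2)))) * g).map σ =
      (Matrix.of fun i j : Fin 3 => y (finProdFinEquiv (finProdFinEquiv (i, j), (0 : Fin 2))) -
          θ * y (finProdFinEquiv (finProdFinEquiv (i, j), (1 : Fin 2)))) * g.map σ := by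
  rw [Matrix.map_mul]
  congr 1
  ext i j
  simp only [Matrix.map_apply, Matrix.of_apply, map_add, map_mul, hθ, hy, neg_mul, sub_eq_add_neg]

/-- **FILE 2's letter**: with `P` from `exists_mvPolynomial_twistedNorm_discr` at `h = σ g`, for every `σ`-FIXED `y` whose chart matrix `δ = X_y·g` has
`det σδ ≠ 0` and whose twisted norm `δ·(B·((σδ)⁻¹)ᵀ·C)` is NOT regular semisimple, `eval_y P = 0` (§2 + `map_chart_mul_eq_of_fixed`).
[cite: Rogawski1990, §3.11 p. 34] [cite: HarishChandra1970, Lemma 42] -/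
theorem twistedNorm_discr_eval_eq_zero_of_fixed (hθ : σ θ = -θ) (g B C : Matrix (Fin 3) (Fin 3) K)
    (P : MvPolynomial (Fin 18) K)
    (hP : ∀ y : Fin 18 → K,
        MvPolynomial.eval y P =
          ((Matrix.of fun i j : Fin 3 => y (finProdFinEquiv (finProdFinEquiv (i, j), (0 : Fin 2))) +
                θ * y (finProdFinEquiv (finProdFinEquiv (i, j), (1 : Fin 2)))) * g * B *
            (adjugate ((Matrix.of fun i j : Fin 3 => y (finProdFinEquiv (finProdFinEquiv (i, j), (0 : Fin 2))) -
                θ * y (finProdFinEquiv (finProdFinEquiv (i, j), (1 : Fin 2)))) * g.map σ))ᵀ * C).charpoly.discr)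
    (y : Fin 18 → K) (hy : ∀ n, σ (y n) = y n)
    (hdet : ((((Matrix.of fun i j : Fin 3 => y (finProdFinEquiv (finProdFinEquiv (i, j), (0 : Fin 2))) +
          θ * y (finProdFinEquiv (finProdFinEquiv (i, j), (1 : Fin 2)))) * g).map σ).det) ≠ 0)
    (hns : ¬ (((Matrix.of fun i j : Fin 3 => y (finProdFinEquiv (finProdFinEquiv (i, j), (0 : Fin 2))) +
          θ * y (finProdFinEquiv (finProdFinEquiv (i, j), (1 : Fin 2)))) * g) *
        (B * ((((Matrix.of fun i j : Fin 3 => y (finProdFinEquiv (finProdFinEquiv (i, j), (0 : Fin 2))) +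
          θ * y (finProdFinEquiv (finProdFinEquiv (i, j), (1 : Fin 2)))) * g).map σ)⁻¹)ᵀ * C)).charpoly.Separable) :
    MvPolynomial.eval y P = 0 := by
  rw [hP y]
  have h2 := discr_charpoly_twistedNorm_eq_zero_of_not_separable σ B C _ hdet hns
  rw [map_chart_mul_eq_of_fixed σ θ hθ g y hy] at h2
  simpa only [Matrix.mul_assoc] using h2

end Poly

end Summit.HodgeConjecture.HodgeConjecture.R90.S4

end
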